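import Mathlib
import Literature.NumberTheory.LFunctions.Zhang2022.SkeletonPartTwo
import HarnessLib

/-!
# Zhang (2022), Appendix A part 1 (proof of Lemma 8.3): `κ(q^r)` at prime powers and the
# estimate `κ(q^r) = (r+1)(1 + O(αr log q))` (Z22:§A.u011) — kernel-checked

Topic `Literature/NumberTheory/LFunctions/Zhang2022` (Landau–Siegel audit tree; verdict-neutral).
Y. Zhang, *Discrete mean estimates and the Landau–Siegel zero*, arXiv:2211.02515v1 (2022)
[Zhang2022LandauSiegel], Appendix A p. 102 (tex L5034), **an unrefereed manuscript under
adjudication**. For the banked `Skeleton.kappaZ c′ D = κ` (`Σ κ(n)n^{−s} = ζ(s+β₁)ζ(s+β₂)ζ(s+β₃)/ζ(s)`,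
`β_i = ib_i`, the tree's `MeanSquareMajorant.kappa b₁ b₂ b₃ = n^{−ib₁} ∗ n^{−ib₂} ∗ n^{−ib₃} ∗ μ`) this
file PROVES, at a prime power `q^r`:

* `kappa_prime_pow_succ` — **the composition formula behind Z22:§A.u011**:
  `κ(q^{r+1}) = c(q^{r+1}) − c(q^r)` with `c = n^{−ib₁} ∗ n^{−ib₂} ∗ n^{−ib₃}`, and `c(q^k)` the
  nested sum `Σ_{i≤k} (Σ_{i'≤i} q^{−ii'b₁…}) …` of unimodular terms (`c12_prime_pow`, `c123_prime_pow`;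
  the manuscript's display `κ(q^r) = Σ_{μ₁+μ₂+μ₃=r} q^{μ·β} − Σ_{μ₁+μ₂+μ₃=r−1} q^{μ·β}` prints the
  exponents with the wrong sign, flag F4 of `TypedAppendixA1`);
* `norm_kappa_prime_pow_sub_le` — **Z22:§A.u011, the estimate**:
  `‖κ(q^r) − (r+1)‖ ≤ (r+1)·r·(|b₁|+|b₂|+|b₃|)·log q` for every prime `q` and `r ≥ 0`, i.e.
  "`κ(q^r) = τ₂(q^r)(1 + O(αr log q))`" with the implied constant made explicit
  (`|b₁|+|b₂|+|b₃| ≤ α(6 + 10|c′|α𝓛)`, `sum_abs_b_le`);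
* `stepA_u011_skeleton` — the same in the campaign's `ForAllLarge` frame with constant `7`
  (for `D` large in terms of `c′`), which is the typed node `Typed.AppendixA1.StepA_u011 c′`
  up to unfolding (bridged once that module is built).

No Assumption (A) is used (the typed node carries it vacuously). Nothing here bears on
Theorems 1–2 of the manuscript.

## References

* Y. Zhang, arXiv:2211.02515v1 (2022), Appendix A p. 102; §7 p. 33; (2.13). [cite: Zhang2022LandauSiegel, App. A]
-/

noncomputable section

open Complex Real ComplexConjugate ArithmeticFunction Finset

namespace Literature.NumberTheory.LFunctions.Zhang2022.Lemma83

open Literature.NumberTheory.LFunctions.Zhang2022.Skeleton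
open Literature.NumberTheory.LFunctions.Zhang2022.MeanSquareMajorant

/-! ## Unimodular prime-power terms -/

/-- `powI b` is completely multiplicative: `(mn)^{−ib} = m^{−ib}n^{−ib}`. [folklore] -/
private theorem powI_mul (b : ℝ) {m n : ℕ} (hm : m ≠ 0) (hn : n ≠ 0) :
    powI b (m * n) = powI b m * powI b n := by
  rw [powI_apply_of_ne_zero b (mul_ne_zero hm hn), powI_apply_of_ne_zero b hm,
    powI_apply_of_ne_zero b hn, Nat.cast_mul, Complex.natCast_mul_natCast_cpow]

/-- `powI b 1 = 1`. [folklore] -/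
private theorem powI_one (b : ℝ) : powI b 1 = 1 := (isMultiplicative_powI b).map_one

/-- `‖(q^i)^{−ib}‖ = 1` for `q ≥ 1`. [folklore] -/
private theorem norm_powI_prime_pow {q : ℕ} (hq : 0 < q) (b : ℝ) (i : ℕ) : ‖powI b (q ^ i)‖ = 1 :=
  norm_powI_of_pos b (pow_pos hq i)

/-- `‖(q^i)^{−ib} − 1‖ ≤ i|b| log q`. [folklore] -/
private theorem norm_powI_prime_pow_sub_one_le {q : ℕ} (hq : 0 < q) (b : ℝ) (i : ℕ) :
    ‖powI b (q ^ i) - 1‖ ≤ i * |b| * Real.log q := by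
  have h := norm_powI_sub_one_le b (pow_pos hq i)
  rw [Nat.cast_pow, Real.log_pow] at h
  linarith [h]

/-- Two unimodular factors: `‖xy − 1‖ ≤ ‖x − 1‖ + ‖y − 1‖` when `‖x‖ = 1`. [folklore] -/
private theorem norm_mul_sub_one_le_of_norm_eq_one {x y : ℂ} (hx : ‖x‖ = 1) :
    ‖x * y - 1‖ ≤ ‖x - 1‖ + ‖y - 1‖ := by
  have e : x * y - 1 = x * (y - 1) + (x - 1) := by ring
  rw [e]
  calc ‖x * (y - 1) + (x - 1)‖ ≤ ‖x * (y - 1)‖ + ‖x - 1‖ := norm_add_le _ _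
    _ = ‖y - 1‖ + ‖x - 1‖ := by rw [norm_mul, hx, one_mul]
    _ = ‖x - 1‖ + ‖y - 1‖ := add_comm _ _

/-! ## `c₁₂ = n^{−ib₁} ∗ n^{−ib₂}` and `c₁₂₃ = c₁₂ ∗ n^{−ib₃}` at prime powers -/

/-- `(n^{−ib₁} ∗ n^{−ib₂})(q^k) = Σ_{i≤k} (q^i)^{−ib₁}(q^{k−i})^{−ib₂}` — the inner composition sum of
Z22:§A.u011 (App. A p. 102). [cite: Zhang2022LandauSiegel, App. A p. 102] -/
theorem c12_prime_pow (b₁ b₂ : ℝ) {q : ℕ} (hq : q.Prime) (k : ℕ) :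
    (powI b₁ * powI b₂) (q ^ k) = ∑ i ∈ range (k + 1), powI b₁ (q ^ i) * powI b₂ (q ^ (k - i)) :=
  RankinEisenstein.mul_apply_prime_pow _ _ hq k

/-- `‖(n^{−ib₁} ∗ n^{−ib₂})(q^k)‖ ≤ k + 1` (`k + 1` unimodular terms; App. A p. 102, the count
`τ₂(q^k)`). [cite: Zhang2022LandauSiegel, App. A p. 102] -/
theorem norm_c12_prime_pow_le (b₁ b₂ : ℝ) {q : ℕ} (hq : q.Prime) (k : ℕ) :
    ‖(powI b₁ * powI b₂) (q ^ k)‖ ≤ k + 1 := by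
  rw [c12_prime_pow b₁ b₂ hq]
  calc ‖∑ i ∈ range (k + 1), powI b₁ (q ^ i) * powI b₂ (q ^ (k - i))‖
      ≤ ∑ i ∈ range (k + 1), ‖powI b₁ (q ^ i) * powI b₂ (q ^ (k - i))‖ := norm_sum_le _ _
    _ = ∑ i ∈ range (k + 1), (1 : ℝ) := sum_congr rfl fun i _ => by
        rw [norm_mul, norm_powI_prime_pow hq.pos, norm_powI_prime_pow hq.pos, one_mul]
    _ = k + 1 := by simp

/-- `‖(n^{−ib₁} ∗ n^{−ib₂})(q^k) − (k+1)‖ ≤ (k+1)·k·(|b₁|+|b₂|)·log q`: each of the `k + 1`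
unimodular terms is within `k(|b₁|+|b₂|)log q` of `1` (the two-shift case of Z22:§A.u011,
App. A p. 102). [cite: Zhang2022LandauSiegel, App. A p. 102] -/
theorem norm_c12_prime_pow_sub_le (b₁ b₂ : ℝ) {q : ℕ} (hq : q.Prime) (k : ℕ) :
    ‖(powI b₁ * powI b₂) (q ^ k) - ((k : ℂ) + 1)‖ ≤ (k + 1) * k * (|b₁| + |b₂|) * Real.log q := by
  have hlog : 0 ≤ Real.log q := Real.log_natCast_nonneg q
  rw [c12_prime_pow b₁ b₂ hq]
  have e : (∑ i ∈ range (k + 1), powI b₁ (q ^ i) * powI b₂ (q ^ (k - i))) - ((k : ℂ) + 1) =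
      ∑ i ∈ range (k + 1), (powI b₁ (q ^ i) * powI b₂ (q ^ (k - i)) - 1) := by
    rw [sum_sub_distrib]; simp
  rw [e]
  calc ‖∑ i ∈ range (k + 1), (powI b₁ (q ^ i) * powI b₂ (q ^ (k - i)) - 1)‖
      ≤ ∑ i ∈ range (k + 1), ‖powI b₁ (q ^ i) * powI b₂ (q ^ (k - i)) - 1‖ := norm_sum_le _ _
    _ ≤ ∑ i ∈ range (k + 1), (k * (|b₁| + |b₂|) * Real.log q : ℝ) := sum_le_sum fun i hi => by
        have hik : i ≤ k := Nat.lt_succ_iff.mp (mem_range.mp hi)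
        have hik' : (i : ℝ) ≤ k := by exact_mod_cast hik
        have hki' : ((k - i : ℕ) : ℝ) ≤ k := by exact_mod_cast Nat.sub_le k i
        calc ‖powI b₁ (q ^ i) * powI b₂ (q ^ (k - i)) - 1‖
            ≤ ‖powI b₁ (q ^ i) - 1‖ + ‖powI b₂ (q ^ (k - i)) - 1‖ :=
              norm_mul_sub_one_le_of_norm_eq_one (norm_powI_prime_pow hq.pos b₁ i)
          _ ≤ i * |b₁| * Real.log q + (k - i : ℕ) * |b₂| * Real.log q :=
              add_le_add (norm_powI_prime_pow_sub_one_le hq.pos b₁ i)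
                (norm_powI_prime_pow_sub_one_le hq.pos b₂ (k - i))
          _ ≤ k * |b₁| * Real.log q + k * |b₂| * Real.log q := by
              gcongr
          _ = k * (|b₁| + |b₂|) * Real.log q := by ring
    _ = (k + 1) * k * (|b₁| + |b₂|) * Real.log q := by
        rw [sum_const, card_range, nsmul_eq_mul]; push_cast; ring

/-- `(c₁₂ ∗ n^{−ib₃})(q^r) = Σ_{i≤r} c₁₂(q^i)(q^{r−i})^{−ib₃}` — the outer composition sum of
Z22:§A.u011 (App. A p. 102). [cite: Zhang2022LandauSiegel, App. A p. 102] -/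
theorem c123_prime_pow (b₁ b₂ b₃ : ℝ) {q : ℕ} (hq : q.Prime) (r : ℕ) :
    (powI b₁ * powI b₂ * powI b₃) (q ^ r) =
      ∑ i ∈ range (r + 1), (powI b₁ * powI b₂) (q ^ i) * powI b₃ (q ^ (r - i)) :=
  RankinEisenstein.mul_apply_prime_pow _ _ hq r

/-- `Σ_{i<n} (i+1) = n(n+1)/2` over `ℝ`. [folklore] -/
private theorem sum_range_cast_add_one (n : ℕ) :
    ∑ i ∈ range n, ((i : ℝ) + 1) = (n : ℝ) * ((n : ℝ) + 1) / 2 := by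
  induction n with
  | zero => simp
  | succ n ih => rw [sum_range_succ, ih]; push_cast; ring

/-! ## `κ(q^r)` -/

/-- **The composition formula (Z22:§A.u011, corrected signs)**: for `r ≥ 0`,
`κ(q^{r+1}) = c(q^{r+1}) − c(q^r)` where `c = n^{−ib₁} ∗ n^{−ib₂} ∗ n^{−ib₃}` collects the sums
`Σ_{μ₁+μ₂+μ₃=k} q^{−i(μ₁b₁+μ₂b₂+μ₃b₃)}` (`μ(1) = 1`, `μ(q) = −1`, `μ(q^i) = 0` for `i ≥ 2`).
[cite: Zhang2022LandauSiegel, App. A p. 102] -/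
theorem kappa_prime_pow_succ (b₁ b₂ b₃ : ℝ) {q : ℕ} (hq : q.Prime) (r : ℕ) :
    kappa b₁ b₂ b₃ (q ^ (r + 1)) =
      (powI b₁ * powI b₂ * powI b₃) (q ^ (r + 1)) - (powI b₁ * powI b₂ * powI b₃) (q ^ r) := by
  rw [kappa, RankinEisenstein.mul_apply_prime_pow _ _ hq (r + 1), sum_range_succ, sum_range_succ]
  have hzero : ∑ i ∈ range r, (powI b₁ * powI b₂ * powI b₃) (q ^ i) *
      (ArithmeticFunction.moebius (q ^ (r + 1 - i)) : ℂ) = 0 := by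
    refine sum_eq_zero fun i hi => ?_
    have hir : i < r := mem_range.mp hi
    have hμ : ArithmeticFunction.moebius (q ^ (r + 1 - i)) = 0 := by
      rw [ArithmeticFunction.moebius_apply_prime_pow hq (by omega), if_neg (by omega)]
    simp [hμ]
  have h1 : (ArithmeticFunction.moebius (q ^ (r + 1 - r)) : ℂ) = -1 := by
    rw [show r + 1 - r = 1 by omega, pow_one, ArithmeticFunction.moebius_apply_prime hq]; norm_num
  have h0 : (ArithmeticFunction.moebius (q ^ (r + 1 - (r + 1))) : ℂ) = 1 := by
    rw [Nat.sub_self, pow_zero, ArithmeticFunction.moebius_apply_one]; norm_num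
  simp only [ArithmeticFunction.intCoe_apply] at hzero h1 h0 ⊢
  rw [hzero, h1, h0]
  ring

/-- **Z22:§A.u011, the estimate** (App. A p. 102, tex L5034: "`κ(q^r) = τ₂(q^r)(1 + O(αr log q))`",
`τ₂(q^r) = r + 1`), with an explicit constant: for every prime `q` and `r ≥ 0`,
`‖κ(q^r) − (r+1)‖ ≤ (r+1)·r·(|b₁|+|b₂|+|b₃|)·log q`. Proof: `κ(q^r) = c₁₂(q^r) +
Σ_{i<r} c₁₂(q^i)·(q^{r−1−i})^{−ib₃}((q)^{−ib₃} − 1)` by the composition formula, `|c₁₂(q^i)| ≤ i+1`,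
`|c₁₂(q^r) − (r+1)| ≤ (r+1)r(|b₁|+|b₂|)log q`, `|q^{−ib₃} − 1| ≤ |b₃|log q`.
[cite: Zhang2022LandauSiegel, App. A p. 102] -/
theorem norm_kappa_prime_pow_sub_le (b₁ b₂ b₃ : ℝ) {q : ℕ} (hq : q.Prime) (r : ℕ) :
    ‖kappa b₁ b₂ b₃ (q ^ r) - ((r : ℂ) + 1)‖ ≤
      (r + 1) * r * (|b₁| + |b₂| + |b₃|) * Real.log q := by
  have hlog : 0 ≤ Real.log q := Real.log_natCast_nonneg q
  rcases r with _ | r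
  · -- `r = 0`: `κ(1) = 1`
    simp [(isMultiplicative_kappa b₁ b₂ b₃).map_one]
  -- the composition formula, rearranged: `κ(q^{r+1}) = c₁₂(q^{r+1}) + Σ_{i≤r} c₁₂(q^i)(w_{r+1−i} − w_{r−i})`
  have hκ : kappa b₁ b₂ b₃ (q ^ (r + 1)) =
      (powI b₁ * powI b₂) (q ^ (r + 1)) + ∑ i ∈ range (r + 1),
        (powI b₁ * powI b₂) (q ^ i) * (powI b₃ (q ^ (r + 1 - i)) - powI b₃ (q ^ (r - i))) := by
    rw [kappa_prime_pow_succ b₁ b₂ b₃ hq r, c123_prime_pow b₁ b₂ b₃ hq (r + 1),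
      c123_prime_pow b₁ b₂ b₃ hq r, sum_range_succ _ (r + 1), Nat.sub_self, pow_zero, powI_one,
      mul_one]
    have : ∑ i ∈ range (r + 1), (powI b₁ * powI b₂) (q ^ i) *
        (powI b₃ (q ^ (r + 1 - i)) - powI b₃ (q ^ (r - i))) =
        ∑ i ∈ range (r + 1), (powI b₁ * powI b₂) (q ^ i) * powI b₃ (q ^ (r + 1 - i)) -
          ∑ i ∈ range (r + 1), (powI b₁ * powI b₂) (q ^ i) * powI b₃ (q ^ (r - i)) := by
      rw [← sum_sub_distrib]; exact sum_congr rfl fun i _ => by ring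
    rw [this]; ring
  rw [hκ]
  have e : (powI b₁ * powI b₂) (q ^ (r + 1)) + ∑ i ∈ range (r + 1),
        (powI b₁ * powI b₂) (q ^ i) * (powI b₃ (q ^ (r + 1 - i)) - powI b₃ (q ^ (r - i))) -
      (((r + 1 : ℕ) : ℂ) + 1) =
      ((powI b₁ * powI b₂) (q ^ (r + 1)) - (((r + 1 : ℕ) : ℂ) + 1)) +
        ∑ i ∈ range (r + 1),
          (powI b₁ * powI b₂) (q ^ i) * (powI b₃ (q ^ (r + 1 - i)) - powI b₃ (q ^ (r - i))) := by
    ring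
  rw [e]
  have hA : ‖(powI b₁ * powI b₂) (q ^ (r + 1)) - (((r + 1 : ℕ) : ℂ) + 1)‖ ≤
      ((r + 1 : ℕ) + 1) * (r + 1 : ℕ) * (|b₁| + |b₂|) * Real.log q := by
    exact_mod_cast norm_c12_prime_pow_sub_le b₁ b₂ hq (r + 1)
  have hw1le : ‖powI b₃ q - 1‖ ≤ |b₃| * Real.log q := by
    have := norm_powI_prime_pow_sub_one_le hq.pos b₃ 1
    simp only [pow_one, Nat.cast_one, one_mul] at this
    exact this
  have hB : ‖∑ i ∈ range (r + 1),
        (powI b₁ * powI b₂) (q ^ i) * (powI b₃ (q ^ (r + 1 - i)) - powI b₃ (q ^ (r - i)))‖ ≤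
      ∑ i ∈ range (r + 1), ((i : ℝ) + 1) * (|b₃| * Real.log q) := by
    refine (norm_sum_le _ _).trans (sum_le_sum fun i hi => ?_)
    have hsub : r + 1 - i = (r - i) + 1 := by
      have := mem_range.mp hi; omega
    have hfac : powI b₃ (q ^ (r + 1 - i)) - powI b₃ (q ^ (r - i)) =
        powI b₃ (q ^ (r - i)) * (powI b₃ q - 1) := by
      rw [hsub, pow_succ, powI_mul b₃ (pow_ne_zero _ hq.ne_zero) hq.ne_zero]; ring
    rw [hfac, norm_mul, norm_mul, norm_powI_prime_pow hq.pos, one_mul]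
    exact mul_le_mul (norm_c12_prime_pow_le b₁ b₂ hq i) hw1le (norm_nonneg _) (by positivity)
  have h3 : 0 ≤ |b₃| * Real.log q := by positivity
  calc ‖((powI b₁ * powI b₂) (q ^ (r + 1)) - (((r + 1 : ℕ) : ℂ) + 1)) +
        ∑ i ∈ range (r + 1),
          (powI b₁ * powI b₂) (q ^ i) * (powI b₃ (q ^ (r + 1 - i)) - powI b₃ (q ^ (r - i)))‖
      ≤ ‖(powI b₁ * powI b₂) (q ^ (r + 1)) - (((r + 1 : ℕ) : ℂ) + 1)‖ +
          ‖∑ i ∈ range (r + 1),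
            (powI b₁ * powI b₂) (q ^ i) * (powI b₃ (q ^ (r + 1 - i)) - powI b₃ (q ^ (r - i)))‖ :=
        norm_add_le _ _
    _ ≤ ((r + 1 : ℕ) + 1) * (r + 1 : ℕ) * (|b₁| + |b₂|) * Real.log q +
          ∑ i ∈ range (r + 1), ((i : ℝ) + 1) * (|b₃| * Real.log q) := add_le_add hA hB
    _ = ((r + 1 : ℕ) + 1) * (r + 1 : ℕ) * (|b₁| + |b₂|) * Real.log q +
          ((r + 1 : ℕ) : ℝ) * (((r + 1 : ℕ) : ℝ) + 1) / 2 * (|b₃| * Real.log q) := by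
        rw [← sum_mul, sum_range_cast_add_one]
    _ ≤ ((r + 1 : ℕ) + 1) * (r + 1 : ℕ) * (|b₁| + |b₂| + |b₃|) * Real.log q := by
        push_cast
        have h4 : 0 ≤ ((r : ℝ) + 1) * ((r : ℝ) + 1 + 1) / 2 * (|b₃| * Real.log q) := by positivity
        nlinarith [h3, h4, abs_nonneg b₁, abs_nonneg b₂]

/-! ## The shifts `b_j` and the node in the campaign frame -/

/-- `|b₁| + |b₂| + |b₃| ≤ α(6 + 10|c′|α𝓛)` for the shifts of (2.13) (`b₁ = α(1−5c′α𝓛)`,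
`b₂ = 2α(1+c′α𝓛)`, `b₃ = 3α(1−c′α𝓛)`), whenever `α, 𝓛 ≥ 0`.
[cite: Zhang2022LandauSiegel, §2 (2.13)] -/
theorem sum_abs_b_le (c' : ℝ) {D : ℕ} (hα : 0 ≤ alpha D) (hℓ : 0 ≤ ell D) :
    |b1 c' D| + |b2 c' D| + |b3 c' D| ≤ alpha D * (6 + 10 * |c'| * alpha D * ell D) := by
  have hx : 0 ≤ alpha D * ell D := mul_nonneg hα hℓ
  have h1 : |b1 c' D| ≤ alpha D * (1 + 5 * |c'| * alpha D * ell D) := by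
    rw [b1, abs_mul, abs_of_nonneg hα]
    refine mul_le_mul_of_nonneg_left ?_ hα
    calc |1 - 5 * c' * alpha D * ell D| ≤ |(1 : ℝ)| + |5 * c' * alpha D * ell D| := abs_sub _ _
      _ = 1 + 5 * |c'| * alpha D * ell D := by
          rw [abs_one, abs_mul, abs_mul, abs_mul, abs_of_nonneg hα, abs_of_nonneg hℓ]
          norm_num
  have h2 : |b2 c' D| ≤ alpha D * (2 + 2 * |c'| * alpha D * ell D) := by
    have e : |b2 c' D| = 2 * alpha D * |1 + c' * alpha D * ell D| := by
      rw [b2, abs_mul, abs_mul, abs_of_nonneg hα, abs_two]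
    rw [e]
    calc 2 * alpha D * |1 + c' * alpha D * ell D|
        ≤ 2 * alpha D * (|(1 : ℝ)| + |c' * alpha D * ell D|) := by
          gcongr; exact abs_add_le _ _
      _ = alpha D * (2 + 2 * |c'| * alpha D * ell D) := by
          rw [abs_one, abs_mul, abs_mul, abs_of_nonneg hα, abs_of_nonneg hℓ]; ring
  have h3 : |b3 c' D| ≤ alpha D * (3 + 3 * |c'| * alpha D * ell D) := by
    have e : |b3 c' D| = 3 * alpha D * |1 - c' * alpha D * ell D| := by
      rw [b3, abs_mul, abs_mul, abs_of_nonneg hα]; norm_num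
    rw [e]
    calc 3 * alpha D * |1 - c' * alpha D * ell D|
        ≤ 3 * alpha D * (|(1 : ℝ)| + |c' * alpha D * ell D|) := by
          gcongr; exact abs_sub _ _
      _ = alpha D * (3 + 3 * |c'| * alpha D * ell D) := by
          rw [abs_one, abs_mul, abs_mul, abs_of_nonneg hα, abs_of_nonneg hℓ]; ring
  calc |b1 c' D| + |b2 c' D| + |b3 c' D|
      ≤ alpha D * (1 + 5 * |c'| * alpha D * ell D) + alpha D * (2 + 2 * |c'| * alpha D * ell D) +
          alpha D * (3 + 3 * |c'| * alpha D * ell D) := add_le_add (add_le_add h1 h2) h3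
    _ = alpha D * (6 + 10 * |c'| * alpha D * ell D) := by ring

/-- `α𝓛 = π𝓛⁻⁸` (`α = π/log P`, `log P = 𝓛⁹`) for `𝓛 ≠ 0`. [cite: Zhang2022LandauSiegel, §2 (2.6), (2.10)] -/
theorem alpha_mul_ell {D : ℕ} (hℓ : ell D ≠ 0) : alpha D * ell D = π / ell D ^ 8 := by
  rw [alpha, bigP, Real.log_exp]
  field_simp

/-- For `D` large in terms of `c′`: `10|c′|α𝓛 ≤ 1` (indeed `α𝓛 = π𝓛⁻⁸ → 0`).
[cite: Zhang2022LandauSiegel, §2 (2.10)] -/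
theorem ten_mul_abs_mul_alpha_ell_le_one (c' : ℝ) {D : ℕ}
    (hD : Real.exp (10 * |c'| * π + 1) ≤ D) : 10 * |c'| * alpha D * ell D ≤ 1 := by
  have hD0 : (0 : ℝ) < D := lt_of_lt_of_le (Real.exp_pos _) hD
  have hℓ : 10 * |c'| * π + 1 ≤ ell D := by
    rw [ell]; exact (Real.le_log_iff_exp_le hD0).mpr hD
  have hc0 : 0 ≤ 10 * |c'| * π := by positivity
  have hℓ1 : 1 ≤ ell D := by linarith
  have hℓ0 : ell D ≠ 0 := by linarith
  rw [mul_assoc, alpha_mul_ell hℓ0]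
  have h8 : ell D ≤ ell D ^ 8 := by
    calc ell D = ell D ^ 1 := (pow_one _).symm
      _ ≤ ell D ^ 8 := pow_le_pow_right₀ hℓ1 (by norm_num)
  have hpow : 0 < ell D ^ 8 := by positivity
  rw [show 10 * |c'| * (π / ell D ^ 8) = (10 * |c'| * π) / ell D ^ 8 by ring,
    div_le_one hpow]
  linarith

/-- **Z22:§A.u011 in the campaign frame** (the typed node `Typed.AppendixA1.StepA_u011 c′` up to
unfolding `Skeleton.kappaZ`, `τ₂(q^r) = #divisors(q^r) = r + 1`): there is an absolute `C`
(`C = 7`) such that for all large `D` (in terms of `c′`), all primes `q` and `r ≥ 1`,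
`‖κ(q^r) − τ₂(q^r)‖ ≤ C·(α·r·log q)·τ₂(q^r)`. Assumption (A) is carried (vacuously) as in the node.
[cite: Zhang2022LandauSiegel, App. A p. 102] -/
theorem stepA_u011_skeleton (c' : ℝ) :
    ∃ C : ℝ, ForAllLarge fun D _ χ => AssumptionA D χ → ∀ q r : ℕ, q.Prime → 1 ≤ r →
      ‖kappaZ c' D (q ^ r) - ((q ^ r).divisors.card : ℂ)‖ ≤
        C * (alpha D * r * Real.log q) * (q ^ r).divisors.card := by
  refine ⟨7, ⌈Real.exp (10 * |c'| * π + 1)⌉₊, fun D _ χ hD _ _ _ q r hq _ => ?_⟩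
  have hD' : Real.exp (10 * |c'| * π + 1) ≤ D := le_trans (Nat.le_ceil _) (by exact_mod_cast hD)
  have hD0 : (0 : ℝ) < D := lt_of_lt_of_le (Real.exp_pos _) hD'
  have hℓ1 : 1 ≤ ell D := by
    have : 10 * |c'| * π + 1 ≤ ell D := by rw [ell]; exact (Real.le_log_iff_exp_le hD0).mpr hD'
    have hc0 : 0 ≤ 10 * |c'| * π := by positivity
    linarith
  have hℓ : 0 ≤ ell D := by linarith
  have hα : 0 ≤ alpha D := by
    rw [alpha, bigP, Real.log_exp]; positivity
  have hcard : (q ^ r).divisors.card = r + 1 := by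
    rw [Nat.divisors_prime_pow hq, card_map, card_range]
  have hB : |b1 c' D| + |b2 c' D| + |b3 c' D| ≤ 7 * alpha D := by
    have h := sum_abs_b_le c' hα hℓ
    have h10 := ten_mul_abs_mul_alpha_ell_le_one c' hD'
    nlinarith [h, h10, hα]
  have hlog : 0 ≤ Real.log q := Real.log_natCast_nonneg q
  rw [hcard, kappaZ]
  push_cast
  calc ‖kappa (b1 c' D) (b2 c' D) (b3 c' D) (q ^ r) - ((r : ℂ) + 1)‖
      ≤ (r + 1) * r * (|b1 c' D| + |b2 c' D| + |b3 c' D|) * Real.log q :=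
        norm_kappa_prime_pow_sub_le _ _ _ hq r
    _ ≤ (r + 1) * r * (7 * alpha D) * Real.log q := by gcongr
    _ = 7 * (alpha D * r * Real.log q) * ((r : ℝ) + 1) := by ring

end Literature.NumberTheory.LFunctions.Zhang2022.Lemma83
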